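import Mathlib.Analysis.ODE.Gronwall
import Literature.Geometry.Lorentzian.Basic
import Literature.Geometry.Lorentzian.CoordCurvature
import HarnessLib

/-!
# Crux `GapExhaustion` (stmt-FinalStateConjecture-10808), line `photon-shell-pseudoconvexity`:
# stub (K-D) `stub_killingUniqueContinuation_of` — local unique continuation of Killing fields

Route `BartnikGapSettling`; helper (`--supports stmt-FinalStateConjecture-10808`) landing the
registered sub-stub (K-D) of line lead c8, wave 2: the LOCAL unique continuation of coordinate
Killing vector fields from a `1`-jet (O'Neill 1983, Ch. 9, Lemma 9.28 in local form; the patching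
tool of the Ionescu–Klainerman sweeps). A Killing field of the metric components `G` on a
connected open set `V ⊆ E4` (`IsMetricOn G V`) is a `C²` map `K : E4 → E4` with
`DG(x)(K x)(Y, Z) + G x (DK(x) Y) Z + G x Y (DK(x) Z) = 0` on `V`; if `K x₀ = 0` and
`DK(x₀) = 0` at one point `x₀ ∈ V`, then `K = 0` on `V`.

The statement is in implication form, conditional on its three analytic inputs (the other
registered stubs of the wave), and the proof is pure glue:

* (prolongation) the classical prolongation identity `∂_X(∇K · Y) = R(X, K)Y − Γ_X(∇_Y K)
  + ∇_{Γ(X,Y)} K`, closing the first-order system for the `1`-jet `(K, DK)`;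
* (K-B) the generic first-order vanishing principle: `‖DF‖ ≤ c ‖F‖` on a connected open set with
  `c` continuous and `F x₀ = 0` forces `F = 0` (Grönwall along segments + open–closed argument);
* (K-C) the prolongation identity yields the bound of (K-B) for `F = (K, DK)`.

Given these, apply (K-B) in the product space `E4 × (E4 →L[ℝ] E4)` to `F = (K, DK)`, which is
differentiable on `V` since `K` is `C²` on the open set `V`, and vanishes at `x₀`.
-/

noncomputable section

-- instance search through the nested operator types `E4 →L[ℝ] E4 →L[ℝ] E4 →L[ℝ] ℝ`
set_option maxSynthPendingDepth 3

-- D-0017: single-problem summit, `Summit.<S>.<S>.…` by design (cf. lakefile `weak.linter.dupNamespace`).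
set_option linter.dupNamespace false

namespace Summit.FinalStateConjecture.FinalStateConjecture.Theorems

open Set Filter Literature.Geometry.Lorentzian Literature.Geometry.Lorentzian.MetricCoord
open scoped Topology

/-- The `1`-jet map `y ↦ (K y, DK(y))` of a `C²` map `K` on an open set `V` is differentiable
on `V`. [folklore] -/
private theorem killingUniqueContinuation_differentiableOn_jet {V : Set E4} {K : E4 → E4}
    (hV : IsOpen V) (hK : ContDiffOn ℝ 2 K V) :
    DifferentiableOn ℝ (fun y => (K y, fderiv ℝ K y)) V := by
  have h1 : DifferentiableOn ℝ K V := hK.differentiableOn two_ne_zero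
  have h2 : DifferentiableOn ℝ (fderiv ℝ K) V :=
    (hK.fderiv_of_isOpen (m := 1) hV one_add_one_eq_two.le).differentiableOn one_ne_zero
  exact h1.prodMk h2

/-- **Local unique continuation of Killing fields from a `1`-jet** (O'Neill 1983, Ch. 9,
Lemma 9.28, local coordinate form), conditional on (prolongation), (K-B), (K-C): a `C²` solution
`K` of the coordinate Killing equation of the metric components `G` on a connected open set
`V ⊆ E4` with `K x₀ = 0` and `DK(x₀) = 0` at some `x₀ ∈ V` vanishes identically on `V`.
[cite: ONeill1983, Ch. 9, Lemma 9.28] -/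
theorem stub_killingUniqueContinuation_of :
    (∀ (G : E4 → E4 →L[ℝ] E4 →L[ℝ] ℝ) (V : Set E4) (K : E4 → E4),
      IsMetricOn G V → ContDiffOn ℝ 2 K V →
      (∀ x ∈ V, ∀ Y Z : E4,
        fderiv ℝ G x (K x) Y Z + G x (fderiv ℝ K x Y) Z + G x Y (fderiv ℝ K x Z) = 0) →
      ∀ x ∈ V, ∀ X Y : E4,
        fderiv ℝ (fun y => fderiv ℝ K y Y + chrAt G y Y (K y)) x X =
          riemAt G x X (K x) Y - chrAt G x X (fderiv ℝ K x Y + chrAt G x Y (K x))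
            + (fderiv ℝ K x (chrAt G x X Y) + chrAt G x (chrAt G x X Y) (K x))) →
    (∀ (W : Type) [NormedAddCommGroup W] [NormedSpace ℝ W] (V : Set E4) (F : E4 → W)
      (c : E4 → ℝ) (x₀ : E4),
      IsOpen V → IsConnected V → DifferentiableOn ℝ F V → ContinuousOn c V →
      (∀ x ∈ V, ‖fderiv ℝ F x‖ ≤ c x * ‖F x‖) → x₀ ∈ V → F x₀ = 0 →
      ∀ x ∈ V, F x = 0) →
    (∀ (G : E4 → E4 →L[ℝ] E4 →L[ℝ] ℝ) (V : Set E4) (K : E4 → E4),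
      IsMetricOn G V → ContDiffOn ℝ 2 K V →
      (∀ x ∈ V, ∀ X Y : E4,
        fderiv ℝ (fun y => fderiv ℝ K y Y + chrAt G y Y (K y)) x X =
          riemAt G x X (K x) Y - chrAt G x X (fderiv ℝ K x Y + chrAt G x Y (K x))
            + (fderiv ℝ K x (chrAt G x X Y) + chrAt G x (chrAt G x X Y) (K x))) →
      ∃ c : E4 → ℝ, ContinuousOn c V ∧
        ∀ x ∈ V, ‖fderiv ℝ (fun y => (K y, fderiv ℝ K y)) x‖ ≤ c x * ‖(K x, fderiv ℝ K x)‖) →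
    ∀ (G : E4 → E4 →L[ℝ] E4 →L[ℝ] ℝ) (V : Set E4) (K : E4 → E4) (x₀ : E4),
      IsMetricOn G V → IsConnected V → ContDiffOn ℝ 2 K V →
      (∀ x ∈ V, ∀ Y Z : E4,
        fderiv ℝ G x (K x) Y Z + G x (fderiv ℝ K x Y) Z + G x Y (fderiv ℝ K x Z) = 0) →
      x₀ ∈ V → K x₀ = 0 → fderiv ℝ K x₀ = 0 →
      ∀ x ∈ V, K x = 0 := by
  intro hP hB hC G V K x₀ hG hconn hK hKil hx₀ h0 h1 x hx
  -- the prolongation identity for this Killing field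
  have hid := hP G V K hG hK hKil
  -- the first-order bound on the `1`-jet `(K, DK)`
  obtain ⟨c, hc, hbound⟩ := hC G V K hG hK hid
  -- the `1`-jet vanishes at `x₀`
  have hzero : (fun y => (K y, fderiv ℝ K y)) x₀ = 0 := by
    show (K x₀, fderiv ℝ K x₀) = 0
    rw [h0, h1, Prod.mk_eq_zero]
    exact ⟨rfl, rfl⟩
  -- first-order vanishing principle in the product space
  have hF := hB (E4 × (E4 →L[ℝ] E4)) V (fun y => (K y, fderiv ℝ K y)) c x₀ hG.isOpen hconn
    (killingUniqueContinuation_differentiableOn_jet hG.isOpen hK) hc hbound hx₀ hzero x hx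
  exact (Prod.mk_eq_zero.1 hF).1

end Summit.FinalStateConjecture.FinalStateConjecture.Theorems

end
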